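import Mathlib
import Summits.NavierStokesRegularity.NavierStokesRegularity.Theorems.EulerZoomLiouvillePowerGaugeEulerLiouvilleWeakCommutingLamb
import Summits.NavierStokesRegularity.NavierStokesRegularity.Theorems.EulerZoomLiouvillePowerGaugeEulerLiouvilleSelfSimilarPastProfileEquations
import Summits.NavierStokesRegularity.NavierStokesRegularity.Theorems.EulerZoomLiouvillePowerGaugeEulerLiouvilleClassIsometryTransport
import HarnessLib

/-!
# Crux `EulerZoomLiouville.PowerGaugeEulerLiouville` (stmt-NavierStokesRegularity-19832), stubs `stub_selfSimilarWeakRest` and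
# `stub_selfSimilarC2Needle`: PROFILES COME IN NO `±` PAIRS — exactly self-similar members whose velocity profile is ANTI-EQUIVARIANT
# under a linear isometry `R` of `ℝ³` (`V(Ry) = −R V(y)`) are trivial, in the WEAK class (no regularity) and hence in the `C²` class

Helper file (theorems only; `--supports stmt-NavierStokesRegularity-19832`; def-free).  Hand leafhand-ns-eulerzoomliouville-10 g2; sequel of
`…WeakEvenProfile` (this hand: the point reflection `R = −1`, `V` even) and of hand g1's commutator lane (`…WeakCommutingMember`).

PRINCIPLE.  Seregin's class and the self-similar profile system are `O(3)`-invariant under the EQUIVARIANT action `V ↦ R V(R⁻¹·)`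
(`ClassIsometry.ae_eq_zero_of_conj`), but the sign flip `V ↦ −V` reverses the transport term against the linear Euler-homogeneity terms.  If
`V` is ANTI-equivariant, `V(Ry) = −R V(y)`, the conjugated member `R u(τ, R⁻¹x)` is `−u`: BOTH `u` and `−u` are exactly self-similar members, with
profiles `V` and `−V`.  Their distributional profile equations (`ProfileEquation.weak_profile_equation`) tested with a divergence-free curl pair
`η_ψ = (∂ᵥψ)w − (∂_wψ)v` have the same Lamb term `∫⟪V, Dη[V]⟫` and opposite linear terms; subtracting gives hand g1's Lamb-free curl-tested identity
`γ∫⟪V, Dη_ψ[y]⟫ + (4γ−1)∫⟪V, η_ψ⟫ = 0`, whence triviality by `Loc.selfSimilar_ae_eq_zero_of_weaklyCommuting_profile` (the weak curls are homogeneous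
distributions of degree `−1/γ`, impossible for the class's `L²_loc` gradient, which `Past.profileData_of_past` supplies).

* `WeakAnti.curlTested_of_negPair` — profile level: two exactly self-similar distributional Euler pairs with velocity profiles `V` and `−V`
  (`V, |V|², P₁, P₂ ∈ L¹_loc`) ⇒ the curl-tested identity for `V`;
* `Loc.selfSimilar_ae_eq_zero_of_antiEquivariant_profile` — MEMBER LEVEL, every `0 < ρ ≤ ½`, no `C²`: crux hypotheses verbatim, exact
  self-similarity about the origin, `V(Ry) = −R V(y)` for a linear isometry `R` ⇒ `u = 0` a.e.;
* `Birth.selfSimilar_of_antiEquivariantProfile` — BY NAME in the skeleton's binders (`Birth.InClass`, `Birth.IsExactlySelfSimilar`): a closed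
  sub-stratum of BOTH open self-similar stubs.  Instances: `R = −1` (even profiles, `…WeakEvenProfile`), `R` = reflection in a plane through the
  blow-up point (horizontal components odd, normal component even across the plane), `R` = half-turn about an axis (axial component odd, transverse
  components even under the half-turn), `R = 1` (only `V = 0`).

WHAT THIS IS NOT: not a proof of either stub or of the crux (the generic profile has no such symmetry); nothing about Navier–Stokes. [folklore]
-/

noncomputable section

-- flat `Theorems/<Route><Decl>…` files of one crux share the namespace of the crux (tree convention)
set_option linter.dupNamespace false

open MeasureTheory Set Filter Topology Metric Function TopologicalSpace
open scoped RealInnerProductSpace NNReal ENNReal ContDiff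

namespace Summit.NavierStokesRegularity.NavierStokesRegularity.Theorems.PowerGaugeEulerLiouville

open Literature.Analysis Literature.Analysis.FunctionSpaces Literature.Analysis.FluidPDE

namespace WeakAnti

variable {V : EuclideanSpace ℝ (Fin 3) → EuclideanSpace ℝ (Fin 3)}

/-- **TWO MEMBERS WITH OPPOSITE PROFILES FORCE THE LAMB-FREE CURL-TESTED IDENTITY.**  If `(u₁,p₁)` and `(u₂,p₂)` are distributional Euler pairs
on `(−∞,0) × ℝ³`, exactly self-similar about the origin at the same rate `γ` with velocity profiles `V` and `V₂ = −V` (`V, |V|², P₁, P₂ ∈ L¹_loc`),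
then `γ∫⟪V, Dη_ψ[y]⟫ + (4γ−1)∫⟪V, η_ψ⟫ = 0` for every curl pair: the two distributional profile equations have the same Lamb term and opposite
linear terms. [folklore] -/
theorem curlTested_of_negPair {γ : ℝ}
    {u₁ u₂ : ℝ → EuclideanSpace ℝ (Fin 3) → EuclideanSpace ℝ (Fin 3)} {p₁ p₂ : ℝ → EuclideanSpace ℝ (Fin 3) → ℝ}
    {V₂ : EuclideanSpace ℝ (Fin 3) → EuclideanSpace ℝ (Fin 3)} {P₁ P₂ : EuclideanSpace ℝ (Fin 3) → ℝ}
    (hsol₁ : IsDistributionalNSSolutionOn (slab (EuclideanSpace ℝ (Fin 3)) (Iio 0) isOpen_Iio) 0 0 u₁ p₁)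
    (hu₁ : ∀ τ : ℝ, τ < 0 → u₁ τ = selfSimilarCollapse γ 0 V τ)
    (hp₁ : ∀ τ : ℝ, τ < 0 → p₁ τ = selfSimilarCollapsePressure γ 0 P₁ τ)
    (hsol₂ : IsDistributionalNSSolutionOn (slab (EuclideanSpace ℝ (Fin 3)) (Iio 0) isOpen_Iio) 0 0 u₂ p₂)
    (hu₂ : ∀ τ : ℝ, τ < 0 → u₂ τ = selfSimilarCollapse γ 0 V₂ τ)
    (hp₂ : ∀ τ : ℝ, τ < 0 → p₂ τ = selfSimilarCollapsePressure γ 0 P₂ τ)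
    (hneg : ∀ y : EuclideanSpace ℝ (Fin 3), V₂ y = -V y)
    (hV : LocallyIntegrable V volume) (hV2 : LocallyIntegrable (fun y => ‖V y‖ ^ 2) volume)
    (hP₁ : LocallyIntegrable P₁ volume) (hP₂ : LocallyIntegrable P₂ volume) :
    ∀ ψ : EuclideanSpace ℝ (Fin 3) → ℝ, ContDiff ℝ ∞ ψ → HasCompactSupport ψ → ∀ v w : EuclideanSpace ℝ (Fin 3),
      γ * (∫ y, ⟪V y, fderiv ℝ (fun z : EuclideanSpace ℝ (Fin 3) => fderiv ℝ ψ z v • w - fderiv ℝ ψ z w • v) y y⟫) +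
        (4 * γ - 1) * (∫ y, ⟪V y, fderiv ℝ ψ y v • w - fderiv ℝ ψ y w • v⟫) = 0 := by
  intro ψ hψ hψs v w
  have hηT := isTestFunctionOn_fderiv_smul_sub hψ hψs v w
  have hdivη : ∀ y, VectorCalculus.divergence
      (fun z : EuclideanSpace ℝ (Fin 3) => fderiv ℝ ψ z v • w - fderiv ℝ ψ z w • v) y = 0 :=
    isDivFree_fderiv_smul_sub hψ v w
  -- local integrability of the opposite profile
  have hV₂eq : V₂ = fun y => -V y := funext hneg
  have hV₂ : LocallyIntegrable V₂ volume := by rw [hV₂eq]; exact hV.neg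
  have hV₂2 : LocallyIntegrable (fun y => ‖V₂ y‖ ^ 2) volume := by
    simp_rw [hneg, norm_neg]; exact hV2
  -- the two distributional profile equations, tested with the curl pair
  have H₁ := ProfileEquation.weak_profile_equation hsol₁ hu₁ hp₁ hV hV2 hP₁ hηT
  have H₂ := ProfileEquation.weak_profile_equation hsol₂ hu₂ hp₂ hV₂ hV₂2 hP₂ hηT
  simp only [hdivη, mul_zero, add_zero] at H₁ H₂
  -- the second one in terms of `V`: same Lamb term, opposite linear terms
  have hkey : ∀ y : EuclideanSpace ℝ (Fin 3),
      ⟪V₂ y, fderiv ℝ (fun z : EuclideanSpace ℝ (Fin 3) => fderiv ℝ ψ z v • w - fderiv ℝ ψ z w • v) y (V₂ y)⟫ +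
          γ * ⟪V₂ y, fderiv ℝ (fun z : EuclideanSpace ℝ (Fin 3) => fderiv ℝ ψ z v • w - fderiv ℝ ψ z w • v) y y⟫ +
        (4 * γ - 1) * ⟪V₂ y, fderiv ℝ ψ y v • w - fderiv ℝ ψ y w • v⟫ =
      ⟪V y, fderiv ℝ (fun z : EuclideanSpace ℝ (Fin 3) => fderiv ℝ ψ z v • w - fderiv ℝ ψ z w • v) y (V y)⟫ -
          γ * ⟪V y, fderiv ℝ (fun z : EuclideanSpace ℝ (Fin 3) => fderiv ℝ ψ z v • w - fderiv ℝ ψ z w • v) y y⟫ -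
        (4 * γ - 1) * ⟪V y, fderiv ℝ ψ y v • w - fderiv ℝ ψ y w • v⟫ := by
    intro y
    simp only [hneg, map_neg, inner_neg_left, inner_neg_right, neg_neg]
    ring
  simp_rw [hkey] at H₂
  -- integrability of the three integrands, then subtract
  have hI2 := WeakLamb.integrable_inner_fderiv_apply hV hV2 hηT
  have hI1 : Integrable (fun y => ⟪V y, fderiv ℝ (fun z : EuclideanSpace ℝ (Fin 3) => fderiv ℝ ψ z v • w - fderiv ℝ ψ z w • v) y y⟫)
      volume := WeakCommuting.integrable_inner_test hV (WeakLamb.isTestFunctionOn_fderiv_apply_self hηT)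
  have hI0 : Integrable (fun y => ⟪V y, fderiv ℝ ψ y v • w - fderiv ℝ ψ y w • v⟫) volume :=
    WeakCommuting.integrable_inner_test hV hηT
  have hC' : Integrable (fun y => γ *
      ⟪V y, fderiv ℝ (fun z : EuclideanSpace ℝ (Fin 3) => fderiv ℝ ψ z v • w - fderiv ℝ ψ z w • v) y y⟫) volume :=
    hI1.const_mul γ
  have hD' : Integrable (fun y => (4 * γ - 1) * ⟪V y, fderiv ℝ ψ y v • w - fderiv ℝ ψ y w • v⟫) volume :=
    hI0.const_mul _
  have hX : Integrable (fun y =>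
      ⟪V y, fderiv ℝ (fun z : EuclideanSpace ℝ (Fin 3) => fderiv ℝ ψ z v • w - fderiv ℝ ψ z w • v) y (V y)⟫ +
        γ * ⟪V y, fderiv ℝ (fun z : EuclideanSpace ℝ (Fin 3) => fderiv ℝ ψ z v • w - fderiv ℝ ψ z w • v) y y⟫) volume :=
    hI2.add hC'
  have hX' : Integrable (fun y =>
      ⟪V y, fderiv ℝ (fun z : EuclideanSpace ℝ (Fin 3) => fderiv ℝ ψ z v • w - fderiv ℝ ψ z w • v) y (V y)⟫ -
        γ * ⟪V y, fderiv ℝ (fun z : EuclideanSpace ℝ (Fin 3) => fderiv ℝ ψ z v • w - fderiv ℝ ψ z w • v) y y⟫) volume :=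
    hI2.sub hC'
  rw [integral_add hX hD', integral_add hI2 hC', integral_const_mul, integral_const_mul] at H₁
  rw [integral_sub hX' hD', integral_sub hI2 hC', integral_const_mul, integral_const_mul] at H₂
  linarith

end WeakAnti

/-- **MEMBER LEVEL: an exactly self-similar member of the weak class whose velocity profile is ANTI-EQUIVARIANT under a linear isometry
`R` of `ℝ³` (`V(Ry) = −R V(y)`) is trivial** (every `0 < ρ ≤ ½`, no regularity hypothesis).  The conjugated member `R u(τ,R⁻¹x)`
(`ClassIsometry.ae_eq_zero_of_conj`: again in the class, same constant) is exactly self-similar with profile `R V(R⁻¹·) = −V`; the pair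
(conjugate, original) has opposite profiles, so `WeakAnti.curlTested_of_negPair` and hand g1's `Loc.selfSimilar_ae_eq_zero_of_weaklyCommuting_profile`
(gradient from `Past.profileData_of_past`) kill the conjugate, which is what the transport lemma asks. [folklore] -/
theorem Loc.selfSimilar_ae_eq_zero_of_antiEquivariant_profile {ρ : ℝ} (hρ : 0 < ρ) (hρh : ρ ≤ 1 / 2)
    {u : ℝ → EuclideanSpace ℝ (Fin 3) → EuclideanSpace ℝ (Fin 3)} {p : ℝ → EuclideanSpace ℝ (Fin 3) → ℝ}
    {H : ℝ → EuclideanSpace ℝ (Fin 3) → EuclideanSpace ℝ (Fin 3) →L[ℝ] EuclideanSpace ℝ (Fin 3)} {c : ℝ≥0}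
    (hsw : IsSuitableWeakSolutionOn (slab (EuclideanSpace ℝ (Fin 3)) (Iio 0) isOpen_Iio) 0 0 u p)
    (hH : HasWeakSpatialGradientOn (slab (EuclideanSpace ℝ (Fin 3)) (Iio 0) isOpen_Iio) u H)
    (hgauge : ∀ a : ℝ, 0 < a →
      ENNReal.ofReal (a ^ (2 * ρ)) * cknA a (0 : ℝ × EuclideanSpace ℝ (Fin 3)) u +
          ENNReal.ofReal (a ^ ρ) * cknE a (0 : ℝ × EuclideanSpace ℝ (Fin 3)) H +
        ENNReal.ofReal (a ^ (2 * ρ)) * cknD a (0 : ℝ × EuclideanSpace ℝ (Fin 3)) p ≤ (c : ℝ≥0∞))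
    {V : EuclideanSpace ℝ (Fin 3) → EuclideanSpace ℝ (Fin 3)} {P : EuclideanSpace ℝ (Fin 3) → ℝ}
    (hu : ∀ τ : ℝ, τ < 0 → u τ = selfSimilarCollapse (1 / (2 + ρ)) 0 V τ)
    (hp : ∀ τ : ℝ, τ < 0 → p τ = selfSimilarCollapsePressure (1 / (2 + ρ)) 0 P τ)
    (R : EuclideanSpace ℝ (Fin 3) ≃ₗᵢ[ℝ] EuclideanSpace ℝ (Fin 3))
    (hanti : ∀ y : EuclideanSpace ℝ (Fin 3), V (R y) = -(R (V y))) :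
    uncurry u =ᵐ[volume.restrict (Iio (0 : ℝ) ×ˢ (univ : Set (EuclideanSpace ℝ (Fin 3))))] 0 := by
  have hρ1 : ρ < 1 := by linarith
  -- data of the ORIGINAL member: `V, |V|² ∈ L¹_loc` (its profile gradient and the `A`-gauge), `P ∈ L¹_loc` (the `D`-gauge)
  have hA : ∀ a : ℝ, 0 < a → ENNReal.ofReal (a ^ (2 * ρ)) *
      cknA a (0 : ℝ × EuclideanSpace ℝ (Fin 3)) u ≤ (c : ℝ≥0∞) :=
    fun a ha => le_trans (le_trans le_self_add le_self_add) (hgauge a ha)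
  have hD : ∀ a : ℝ, 0 < a → ENNReal.ofReal (a ^ (2 * ρ)) *
      cknD a (0 : ℝ × EuclideanSpace ℝ (Fin 3)) p ≤ (c : ℝ≥0∞) :=
    fun a ha => le_trans le_add_self (hgauge a ha)
  have hE : ∀ a : ℝ, 0 < a → ENNReal.ofReal (a ^ ρ) *
      cknE a (0 : ℝ × EuclideanSpace ℝ (Fin 3)) H ≤ (c : ℝ≥0∞) :=
    fun a ha => le_trans (le_trans le_add_self le_self_add) (hgauge a ha)
  have hu₀ : ∀ τ : ℝ, τ < 0 → u τ = fun x => selfSimilarCollapse (1 / (2 + ρ)) 0 V τ (x - 0) :=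
    fun τ hτ => by rw [hu τ hτ]; funext x; rw [sub_zero]
  have hp₀ : ∀ τ : ℝ, τ < 0 → p τ = fun x => selfSimilarCollapsePressure (1 / (2 + ρ)) 0 P τ (x - 0) :=
    fun τ hτ => by rw [hp τ hτ]; funext x; rw [sub_zero]
  obtain ⟨G, -, -, -, hG, -⟩ :=
    Past.profileData_of_past hρ hρh le_rfl le_rfl 0 hsw.distributional hH hA hE hD hu₀ hp₀
  have hVli : LocallyIntegrable V volume := locallyIntegrableOn_univ.1 (by
    simpa only [Opens.coe_top] using hG.locallyIntegrableOn)
  have hV2 : LocallyIntegrable (fun y => ‖V y‖ ^ 2) volume :=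
    EnergySaturation.locallyIntegrable_norm_sq_of_growth hVli.aestronglyMeasurable (profile_energy_growth_of_gaugeA hρ hu hA)
  have hpm : AEStronglyMeasurable (uncurry p)
      (volume.restrict (Iio (0 : ℝ) ×ˢ (univ : Set (EuclideanSpace ℝ (Fin 3))))) := by
    have := hsw.distributional.2.2.1.aestronglyMeasurable
    simpa [slab] using this
  have hPm := aestronglyMeasurable_pressureProfile hpm hp
  have hDprof := profile_pressure_weight_of_gaugeD hρ hρ1 hpm hp hD
  have hP1 : LocallyIntegrable P volume :=
    EnergySaturation.locallyIntegrable_pressure_of_weight hρ1 hPm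
      (ENNReal.mul_ne_top ENNReal.ofReal_ne_top ENNReal.coe_ne_top) hDprof
  -- transport to the conjugated member `u' = R u(τ, R⁻¹ ·) = −u`, profile `V' = R V(R⁻¹ ·) = −V`
  refine ClassIsometry.ae_eq_zero_of_conj hsw hH hgauge R ?_
  intro u' p' H' hsw' hH' hg' hu'def hp'def
  subst hu'def hp'def
  have h2ρ : (0 : ℝ) < 2 + ρ := by linarith
  have hu' : ∀ τ : ℝ, τ < 0 → (fun τ x => R (u τ (R.symm x))) τ =
      selfSimilarCollapse (1 / (2 + ρ)) 0 (fun y => R (V (R.symm y))) τ := by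
    intro τ hτ
    funext x
    simp only [hu τ hτ, selfSimilarCollapse_apply, map_smul]
  have hp' : ∀ τ : ℝ, τ < 0 → (fun τ x => p τ (R.symm x)) τ =
      selfSimilarCollapsePressure (1 / (2 + ρ)) 0 (fun y => P (R.symm y)) τ := by
    intro τ hτ
    funext x
    simp only [hp τ hτ, selfSimilarCollapsePressure, map_smul]
  -- the ORIGINAL profile is minus the conjugated one
  have hneg : ∀ y : EuclideanSpace ℝ (Fin 3), V y = -(fun y => R (V (R.symm y))) y := by
    intro y
    have := hanti (R.symm y)
    rw [LinearIsometryEquiv.apply_symm_apply] at this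
    simpa using this
  -- data of the CONJUGATED member
  have hA' : ∀ a : ℝ, 0 < a → ENNReal.ofReal (a ^ (2 * ρ)) *
      cknA a (0 : ℝ × EuclideanSpace ℝ (Fin 3)) (fun τ x => R (u τ (R.symm x))) ≤ (c : ℝ≥0∞) :=
    fun a ha => le_trans (le_trans le_self_add le_self_add) (hg' a ha)
  have hD' : ∀ a : ℝ, 0 < a → ENNReal.ofReal (a ^ (2 * ρ)) *
      cknD a (0 : ℝ × EuclideanSpace ℝ (Fin 3)) (fun τ x => p τ (R.symm x)) ≤ (c : ℝ≥0∞) :=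
    fun a ha => le_trans le_add_self (hg' a ha)
  have hE' : ∀ a : ℝ, 0 < a → ENNReal.ofReal (a ^ ρ) *
      cknE a (0 : ℝ × EuclideanSpace ℝ (Fin 3)) H' ≤ (c : ℝ≥0∞) :=
    fun a ha => le_trans (le_trans le_add_self le_self_add) (hg' a ha)
  have hu'₀ : ∀ τ : ℝ, τ < 0 → (fun τ x => R (u τ (R.symm x))) τ =
      fun x => selfSimilarCollapse (1 / (2 + ρ)) 0 (fun y => R (V (R.symm y))) τ (x - 0) :=
    fun τ hτ => by rw [hu' τ hτ]; funext x; rw [sub_zero]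
  have hp'₀ : ∀ τ : ℝ, τ < 0 → (fun τ x => p τ (R.symm x)) τ =
      fun x => selfSimilarCollapsePressure (1 / (2 + ρ)) 0 (fun y => P (R.symm y)) τ (x - 0) :=
    fun τ hτ => by rw [hp' τ hτ]; funext x; rw [sub_zero]
  obtain ⟨G', -, -, -, hG', -, -, -, -, -, hG'L2, -⟩ :=
    Past.profileData_of_past hρ hρh le_rfl le_rfl 0 hsw'.distributional hH' hA' hE' hD' hu'₀ hp'₀
  have hG'2 : IntegrableOn (fun y => ‖G' y‖ ^ 2) (closedBall (0 : EuclideanSpace ℝ (Fin 3)) 1) volume := by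
    have h2 : Integrable (fun y => ‖G' y‖ ^ 2) (volume.restrict (ball (0 : EuclideanSpace ℝ (Fin 3)) 2)) :=
      (memLp_two_iff_integrable_sq_norm (hG'L2 2).1).1 (hG'L2 2)
    exact IntegrableOn.mono_set h2 (closedBall_subset_ball (by norm_num))
  have hV'li : LocallyIntegrable (fun y => R (V (R.symm y))) volume := locallyIntegrableOn_univ.1 (by
    simpa only [Opens.coe_top] using hG'.locallyIntegrableOn)
  have hV'2 : LocallyIntegrable (fun y => ‖(fun y => R (V (R.symm y))) y‖ ^ 2) volume :=
    EnergySaturation.locallyIntegrable_norm_sq_of_growth hV'li.aestronglyMeasurable (profile_energy_growth_of_gaugeA hρ hu' hA')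
  have hpm' : AEStronglyMeasurable (uncurry (fun τ x => p τ (R.symm x)))
      (volume.restrict (Iio (0 : ℝ) ×ˢ (univ : Set (EuclideanSpace ℝ (Fin 3))))) := by
    have := hsw'.distributional.2.2.1.aestronglyMeasurable
    simpa [slab] using this
  have hP'm := aestronglyMeasurable_pressureProfile hpm' hp'
  have hD'prof := profile_pressure_weight_of_gaugeD hρ hρ1 hpm' hp' hD'
  have hP'1 : LocallyIntegrable (fun y => P (R.symm y)) volume :=
    EnergySaturation.locallyIntegrable_pressure_of_weight hρ1 hP'm
      (ENNReal.mul_ne_top ENNReal.ofReal_ne_top ENNReal.coe_ne_top) hD'prof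
  -- the curl-tested identity for the conjugated profile from the pair (conjugate, original), then hand g1's member theorem
  have hCT := WeakAnti.curlTested_of_negPair hsw'.distributional hu' hp' hsw.distributional hu hp hneg hV'li hV'2 hP'1 hP1
  exact Loc.selfSimilar_ae_eq_zero_of_weaklyCommuting_profile hρ hsw' hH' hg' hu' hG' hG'2 hCT

/-- **NO NEEDLE AND NO WEAK PROFILE IS ANTI-EQUIVARIANT UNDER A LINEAR ISOMETRY** (binder language of the skeleton of record, every
`0 < ρ ≤ ½`, no `C²` hypothesis): a class member (`Birth.InClass`) exactly self-similar about the origin (`Birth.IsExactlySelfSimilar ρ u p V P`)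
with `V(Ry) = −R V(y)` for some linear isometry `R` of `ℝ³` is trivial — a closed sub-stratum of `stub_selfSimilarWeakRest` and of
`stub_selfSimilarC2Needle`.  `R = −1`: even profiles (`Birth.selfSimilar_of_evenProfile`); `R` a reflection in a plane or the half-turn about an
axis through the blow-up point: the «wrong-parity» mirror / half-turn symmetric profiles. [folklore] -/
theorem Birth.selfSimilar_of_antiEquivariantProfile :
    ∀ ρ : ℝ, 0 < ρ → ρ ≤ 1 / 2 →
      ∀ (u : ℝ → EuclideanSpace ℝ (Fin 3) → EuclideanSpace ℝ (Fin 3)) (p : ℝ → EuclideanSpace ℝ (Fin 3) → ℝ)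
        (H : ℝ → EuclideanSpace ℝ (Fin 3) → EuclideanSpace ℝ (Fin 3) →L[ℝ] EuclideanSpace ℝ (Fin 3)) (c : ℝ≥0)
        (V : EuclideanSpace ℝ (Fin 3) → EuclideanSpace ℝ (Fin 3)) (P : EuclideanSpace ℝ (Fin 3) → ℝ),
        Birth.InClass ρ u p H c → Birth.IsExactlySelfSimilar ρ u p V P →
          (∃ R : EuclideanSpace ℝ (Fin 3) ≃ₗᵢ[ℝ] EuclideanSpace ℝ (Fin 3), ∀ y : EuclideanSpace ℝ (Fin 3), V (R y) = -(R (V y))) →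
          uncurry u =ᵐ[volume.restrict (Iio (0 : ℝ) ×ˢ (univ : Set (EuclideanSpace ℝ (Fin 3))))] 0 := by
  intro ρ hρ hρh u p H c V P hcl hss hR
  obtain ⟨R, hanti⟩ := hR
  exact Loc.selfSimilar_ae_eq_zero_of_antiEquivariant_profile hρ hρh hcl.1 hcl.2.1 hcl.2.2 hss.1 hss.2 R hanti

/-- **The same with the symmetry on the MEMBER**: `u(τ, Rx) = −R u(τ, x)` for all `τ < 0` and all `x` (at `τ = −1` the ansatz reads
`u(−1,·) = V`). [folklore] -/
theorem Birth.selfSimilar_of_antiEquivariantMember :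
    ∀ ρ : ℝ, 0 < ρ → ρ ≤ 1 / 2 →
      ∀ (u : ℝ → EuclideanSpace ℝ (Fin 3) → EuclideanSpace ℝ (Fin 3)) (p : ℝ → EuclideanSpace ℝ (Fin 3) → ℝ)
        (H : ℝ → EuclideanSpace ℝ (Fin 3) → EuclideanSpace ℝ (Fin 3) →L[ℝ] EuclideanSpace ℝ (Fin 3)) (c : ℝ≥0)
        (V : EuclideanSpace ℝ (Fin 3) → EuclideanSpace ℝ (Fin 3)) (P : EuclideanSpace ℝ (Fin 3) → ℝ),
        Birth.InClass ρ u p H c → Birth.IsExactlySelfSimilar ρ u p V P →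
          (∃ R : EuclideanSpace ℝ (Fin 3) ≃ₗᵢ[ℝ] EuclideanSpace ℝ (Fin 3),
              ∀ τ : ℝ, τ < 0 → ∀ x : EuclideanSpace ℝ (Fin 3), u τ (R x) = -(R (u τ x))) →
          uncurry u =ᵐ[volume.restrict (Iio (0 : ℝ) ×ˢ (univ : Set (EuclideanSpace ℝ (Fin 3))))] 0 := by
  intro ρ hρ hρh u p H c V P hcl hss hR
  obtain ⟨R, hsym⟩ := hR
  refine Birth.selfSimilar_of_antiEquivariantProfile ρ hρ hρh u p H c V P hcl hss ⟨R, fun y => ?_⟩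
  have h1 := hsym (-1) (by norm_num) y
  rw [hss.1 (-1) (by norm_num)] at h1
  simpa [selfSimilarCollapse_apply] using h1

end Summit.NavierStokesRegularity.NavierStokesRegularity.Theorems.PowerGaugeEulerLiouville

end
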